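import Summits.QuantumFields.YangMills.Theorems.BalabanUVNodesPortS1JacPiecesDefs

/-!
# NODE O port PT-A — `stub_LZjac`'s ANALYTIC ROWS (a)(b) AS ONE DISPLAYED STATEMENT: `JacRowsAB F` — analyticity of the torus Jacobian functional `φ ↦ J_T(c, 𝐔)` and a `k`-uniform bound
# `|J_T(c, 𝐔) − J_T(c, 1)| ≤ E` at the pairs of the record spaces `U^c_{k+1}(X(c), α₀, α₁)` ([I] (1.11)–(1.16)) — the part of the δ-Jacobian sub-half that is COMPLEX ANALYSIS, not packaging

Cell `ym-nodeO-ideate`, porter seat `ymgap-nodeO-port-PTA-1` (gen 6); DEFINITION file (a predicate in the torus family `F`; the statement porter PTZ-1's item (3) — rows (a)(b) of the holomorphic block on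
the (1.11)–(1.16) domain, `…JacobianHoloDomain*` — and the `k`-step road feed), `--supports stmt-QuantumFields-27930`.  [I] = [Balaban1987RG1], [15] = [Balaban1985Variational].
WHY.  The reshape of the skeleton `pta_residueW` this generation replaces the P0-free stub `stub_LZjac : ∀ F, PortRecordLZjacHalf F` by `stub_LZjacAB : ∀ F, JacRowsAB F` through the glue
`lzjacHalf_of_jacRowsAB` (companion file): everything else of the sub-half — the integer-lattice packaging (e), (LOC)(GI), rows (c)(d), the wrap-aware representation (f′)-W, the constants — is
proved from the tree.  WHAT IT SAYS, per torus family `F`: for all large admissible cube letters `Mc` there are radii `α₀, α₁ > 0` and a constant `E ≥ 0` such that for every step `k`, volume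
`recordK₀ F Mc k + n`, coarse bond `c` and complex pair `φ = (𝐔, 𝐉)` whose coordinates lie in `recordUc … X(c)` (the record's (1.11)–(1.16) space of the one-or-two-cube domain of `c`):
`ψ ↦ J_T(c, ψ.1)` is ℂ-analytic at `φ` and `‖J_T(c, 𝐔) − J_T(c, 1)‖ ≤ E` — print's «h(c) is an analytic function … on the space (1.11)–(1.16)» ([I] p.267–268) with the uniform smallness of
the `k`-fold averages of such configurations ([15] Prop. 9 p.309, the scaled norms of (1.11)), for the determinant of the central-bond block.  `J_T` is `SL(2,ℂ)`-gauge invariant as a total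
function (✓ `…JacTorusRows.jacTorus_cAct`), so the statement is insensitive to the saturation (1.16).
* `JacRowsAB F : Prop`.
NOT PROVED HERE, NOT A LITERATURE FACT (it is a statement about the tree's own objects at the record); P0-free (no selector, no `UkSel`, no (α)(β)).

HONEST FRAMING.  A definition; NOTHING of Bałaban asserted or proved; `stub_LZjac` OPEN; 27930 OPEN · no claim; K0⁷∕K-Ax OPEN; NODE O 0∕1; COUNT 8∕28 · K 1∕4 UNMOVED; finite `𝕋⁴_{L^K}` at fixed ε —
NOT continuum ∕ OS ∕ Clay; **the Yang–Mills mass gap is NOT proved by any of this.**  No `sorry`, no `instance`, no `notation`; standard axioms.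
-/

noncomputable section

open scoped BigOperators Matrix.Norms.L2Operator Topology

namespace Summit.QuantumFields.YangMills.Theorems.BalabanUVNodesPortS1

open Summit.QuantumFields.YangMills.Theorems.K0RecordFormatNames
open Literature.MathematicalPhysics.QuantumFieldTheory.Balaban1983to89
open Literature.MathematicalPhysics.QuantumFieldTheory.Balaban1983to89.Node00
open Literature.MathematicalPhysics.QuantumFieldTheory.Balaban1983to89.T4Continuum (T4Family)

/-- ★★ **`JacRowsAB F` — ROWS (a)(b) OF THE δ-JACOBIAN SUB-HALF, DISPLAYED**: for all large admissible `Mc`, radii `α₀ α₁ > 0` and `E ≥ 0` (uniform in `k`, `n`, `c`) with: at every pair `φ` of the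
record space `recordUc F Mc k α₀ α₁ (recordK₀ F Mc k + n) (X(c))`, the torus Jacobian functional `ψ ↦ jacTorus k c ψ.1` is ℂ-analytic at `φ` and `‖jacTorus k c φ.1 − jacTorus k c 1‖ ≤ E`.
[cite: Balaban1987RG1, p.267–268 («h(c)» analytic on (1.11)–(1.16)), (1.18) p.263, (1.11)–(1.16) pp.262–263; Balaban1985Variational, Prop. 9 p.309] -/
def JacRowsAB (F : T4Family) : Prop :=
  ∃ Mth : ℕ, ∀ Mc : ℕ, Mth ≤ Mc → McGuard F Mc → ∃ α₀ α₁ E : ℝ, 0 < α₀ ∧ 0 < α₁ ∧ 0 ≤ E ∧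
    ∀ (k n : ℕ) (c : PBond (F.P (recordK₀ F Mc k + n)) (k + 1)) (φ : Sect2.CPair (F.P (recordK₀ F Mc k + n)) (MatA 2)),
      encodeCfg F (recordK₀ F Mc k + n) φ ∈ recordUc F Mc k α₀ α₁ (recordK₀ F Mc k + n) (domOfBond F Mc k (recordK₀ F Mc k + n) c) →
        AnalyticAt ℂ (fun ψ : Sect2.CPair (F.P (recordK₀ F Mc k + n)) (MatA 2) => jacTorus k c ψ.1) φ ∧
          ‖jacTorus k c φ.1 - jacTorus k c 1‖ ≤ E

end Summit.QuantumFields.YangMills.Theorems.BalabanUVNodesPortS1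

end
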